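import Summits.NavierStokesRegularity.NavierStokesRegularity.Theorems.HodographBetchovSlowClassProductionSliceBound
import Mathlib.Analysis.SpecialFunctions.Integrability.Basic

/-!
# `SlowClassProduction` (stmt-NavierStokesRegularity-15831) — the crux from a power-law slice rate at singular points

Route `HodographBetchov`, crux 2, line `near_field`.  The socket for the Type-I / self-similar census
of the crux idea `type-one-stagnation-census`: if at every singular, `l`-slow-accumulating point
`(x₀, T)` of a maximal solution the absolute production of the slow part `{‖u(s,·)‖ ≤ l}` of a ball
`B(x₀, ρ)` is `≤ C (T − s)^a` slice by slice on `[T − ρ, T)` for some exponent `a > −1` (the census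
predicts `a = (β − 3)/2` with Łojasiewicz exponent `β ≥ 2`, i.e. `a ≥ −1/2`), then
`SlowClassProduction` holds (`integrableOn_powerRate` + `slowClassProduction_of_singularSliceBound`).
-/

noncomputable section

-- the summit and its single problem share the name `NavierStokesRegularity` (D-0017 nested layout)
set_option linter.dupNamespace false

namespace Summit.NavierStokesRegularity.NavierStokesRegularity.Theorems.SlowClassProduction.NearField

open Set MeasureTheory

/-- The power rate `s ↦ (T − s)^a`, `a > −1`, is integrable on `(T − ρ, T)`. [folklore] -/
theorem integrableOn_powerRate {T ρ a : ℝ} (ha : -1 < a) :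
    MeasureTheory.IntegrableOn (fun s : ℝ => (T - s) ^ a) (Set.Ioo (T - ρ) T) := by
  rcases lt_or_ge ρ 0 with hρ | hρ
  · rw [Ioo_eq_empty (by linarith)]
    exact integrableOn_empty
  · have h1 : IntervalIntegrable (fun x : ℝ => x ^ a) volume 0 ρ :=
      intervalIntegral.intervalIntegrable_rpow' ha
    have h2 := h1.comp_sub_left T
    rw [sub_zero, intervalIntegrable_iff, uIoc_comm, uIoc_of_le (by linarith)] at h2
    exact h2.mono_set Ioo_subset_Ioc_self

/-- A constant multiple of the power rate is integrable on `(T − ρ, T)` for `a > −1`. [folklore] -/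
theorem integrableOn_const_mul_powerRate {T ρ a : ℝ} (C : ℝ) (ha : -1 < a) :
    MeasureTheory.IntegrableOn (fun s : ℝ => C * (T - s) ^ a) (Set.Ioo (T - ρ) T) :=
  (integrableOn_powerRate ha).const_mul C

/-- **The crux from a power-law slice rate at singular points.**  If for every `ν, T > 0`, every
maximal smooth solution `(u,p)` with lifespan `T` that is Leray–Hopf from its rapidly decaying
datum, every level `l > 0` and every point `x₀` singular at time `T` and `l`-slow-accumulating, there
are `ρ > 0`, `C` and an exponent `a > −1` such that for every slice `s ∈ [T − ρ, T)` the production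
`P(s,·) = ⟪ω, ∇u ω⟫(s,·)` is integrable on `{‖u(s,·)‖ ≤ l} ∩ B(x₀, ρ)` with
`∫ |P(s,·)| ≤ C (T − s)^a`, then `SlowClassProduction` holds.  (Type-I census: `a = (β−3)/2`,
`β ≥ 2`.) [folklore] -/
theorem slowClassProduction_of_singularPowerRate :
    (∀ (ν T : ℝ), 0 < ν → 0 < T →
      ∀ (u : ℝ → EuclideanSpace ℝ (Fin 3) → EuclideanSpace ℝ (Fin 3))
        (p : ℝ → EuclideanSpace ℝ (Fin 3) → ℝ),
        Literature.Analysis.FluidPDE.IsMaximalSmoothSolution ν 0 u p T →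
        Literature.Analysis.FluidPDE.IsLerayHopfOn T ν 0 (u 0) u →
        Literature.Analysis.FluidPDE.HasRapidSpatialDecay (u 0) →
        ∀ l : ℝ, 0 < l → ∀ x₀ : EuclideanSpace ℝ (Fin 3),
          (∀ r : ℝ, 0 < r → r ^ 2 < T →
            eLpNorm (Function.uncurry u) ⊤ (MeasureTheory.volume.restrict
              (Literature.Analysis.FluidPDE.parabolicCylinder r ((T : ℝ), x₀))) = ⊤) →
          (∀ ρ : ℝ, 0 < ρ → ∃ t ∈ Set.Ico 0 T,
            ({z : ℝ × EuclideanSpace ℝ (Fin 3) | z.1 ∈ Set.Ioo 0 t ∧ ‖u z.1 z.2‖ ≤ l} ∩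
              {z : ℝ × EuclideanSpace ℝ (Fin 3) | T - ρ ≤ z.1 ∧ dist z.2 x₀ < ρ}).Nonempty) →
          ∃ ρ : ℝ, 0 < ρ ∧ ∃ C a : ℝ, -1 < a ∧
            ∀ s ∈ Set.Ico (T - ρ) T,
              MeasureTheory.IntegrableOn
                (fun x : EuclideanSpace ℝ (Fin 3) =>
                  inner ℝ (Literature.Analysis.FluidPDE.curl (u s) x)
                    (fderiv ℝ (u s) x (Literature.Analysis.FluidPDE.curl (u s) x)))
                {x : EuclideanSpace ℝ (Fin 3) | ‖u s x‖ ≤ l ∧ dist x x₀ < ρ} ∧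
              ∫ x in {x : EuclideanSpace ℝ (Fin 3) | ‖u s x‖ ≤ l ∧ dist x x₀ < ρ},
                |inner ℝ (Literature.Analysis.FluidPDE.curl (u s) x)
                  (fderiv ℝ (u s) x (Literature.Analysis.FluidPDE.curl (u s) x))| ≤ C * (T - s) ^ a) →
    Summit.NavierStokesRegularity.NavierStokesRegularity.Theses.HodographBetchov.SlowClassProduction := by
  intro hP
  refine slowClassProduction_of_singularSliceBound ?_
  intro ν T hν hT u p hmax hLH hdec l hl x₀ hsing hacc
  obtain ⟨ρ, hρ, C, a, ha, hslice⟩ := hP ν T hν hT u p hmax hLH hdec l hl x₀ hsing hacc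
  exact ⟨ρ, hρ, fun s => C * (T - s) ^ a, integrableOn_const_mul_powerRate C ha, hslice⟩

end Summit.NavierStokesRegularity.NavierStokesRegularity.Theorems.SlowClassProduction.NearField

end
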